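import Summits.RiemannHypothesis.RiemannHypothesis.Theorems.AsymptoticCriticalLine.Negative.BandForms
import Literature.Barriers.RiemannHypothesis.RamanujanAxiomNecessity
import Literature.Barriers.RiemannHypothesis.BohrDenseValuesVoronin

/-!
# `AsymptoticCriticalLine` (crux `stmt-RiemannHypothesis-2063`, route `RuelleBand`):
# the band with a WIDTH, the special value `0`, and the derivative (negative-side support, cycle 2)

Support file of the crux disprover (cdisprove seat refuter-cdisprove-stmt-RiemannHypothesis-2063-g2-0),
companion of `BandForms.lean` / `ShapeFails.lean`; `bandSet Z ε = {s | Z s = 0 ∧ 0 < Re s ∧ Re s < 1 ∧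
ε ≤ |Re s − 1/2|}` is the band of `BandForms.lean`. Two more pieces of the structure of `ζ` that do
NOT give the band shape `∀ ε > 0, (bandSet Z ε).Finite`, both unconditional and both from theorems
PROVED in the tree:

* THE BAND WITH A WIDTH (`not_band_shiftedZeta`; Hardy 1914 via the proved barrier file
  `Literature/Barriers/RiemannHypothesis/RamanujanAxiomNecessity.lean`): the Eisenstein-type product
  `G_a(s) = ζ(s − a)ζ(s + a)`, `0 < a < 1/2` — degree-2 Euler product over all primes with
  multiplicative coefficients `n^{−a}σ_{2a}(n)` and local roots `p^{±a}` (Selberg's Euler axiom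
  `θ = a < 1/2` holds), EXACT functional equation `Λ_a(s) = Λ_a(1 − s)`, finite order — has an
  infinite band at level `a`: both lines `Re s = 1/2 ± a`. In the route's dictionary: a potential
  off the half-density one by `±a` separates the band edges (`γ₀⁻ = 1/2 − a < γ₀⁺ = 1/2 + a`) and
  both edges are populated — the general Faure–Tsujii shape `{|Re z| ≤ τ}` with `τ = a`. Above width
  `a`, `G_a` has exactly `ζ`'s bands (`bandSet_shiftedZeta_subset`), and the crux is EQUIVALENT to
  "for every `a`, all bands of `G_a` of level `> a` are finite" (`acl_iff_forall_shiftedZeta`): a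
  band theorem that comes with a width parameter is, on this family, exactly as strong as the crux;
  the crux is its width-`0` case and nothing less.
* THE VALUE `0` IS SPECIAL (`bandSet_zeta_sub_const_infinite`; Titchmarsh §11.10, proved in tree
  as `Literature.Barriers.RiemannHypothesis.Titchmarsh1986_aPoints_holds` from Voronin universality):
  for every `a ≠ 0` and EVERY level `0 < ε < 1/2` the band of `ζ − a` is infinite. A proof of the
  crux must separate the value `0` from every other value — go through `log ζ` / the Euler product
  ("resonances = zeros"), not through value-distribution, growth or mean values in `1/2 < σ < 1`,
  which treat all values alike (barrier `BohrDenseValues`).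
* DIFFERENTIATION DESTROYS THE BAND (`bandSet_deriv_zeta_infinite`, `not_band_deriv_zeta`;
  Voronin's disc universality PROVED in tree as
  `Literature.NumberTheory.LFunctions.Steuding2007_thm1_9_discAnalytic_holds`, Cauchy's estimate,
  and the Rouché lemma `exists_zero_of_norm_sub_lt_norm` of `BohrDenseValuesProofs.lean`): `ζ'` has
  zeros above every height in every strip `1/2 < α < σ < β < 1` (`exists_deriv_zeta_zero_gt`), so
  every band of `ζ'` of level `< 1/2` is infinite — through its RIGHT half; its left half is of RH
  strength (Speiser 1934: RH ⟺ `ζ' ≠ 0` in `0 < σ < 1/2`; Levinson–Montgomery 1974). The band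
  property is not inherited under differentiation, and the symmetry `ρ ↦ 1 − ρ̄` that makes the
  one-sided and two-sided cruxes equivalent (`acl_iff_rightBand`) is exactly what `ζ'` lacks.
-/

noncomputable section

namespace Summit.RiemannHypothesis.RiemannHypothesis.Theorems.AsymptoticCriticalLine.Negative

open Complex Set
open Summit.RiemannHypothesis.RiemannHypothesis.Theses.RuelleBand (AsymptoticCriticalLine)

/-! ## 1. Non-half-density potential: the first band acquires width `2a` -/

section shifted

open Literature.Barriers.RiemannHypothesis.RamanujanAxiom

/-- REFUTED STRENGTHENING / BARRIER REDUCTION (unconditional): the band shape fails for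
`G_a = ζ(s − a)ζ(s + a)`, `0 < a < 1/2` — its level-`a` band contains the infinite line
`Re s = 1/2 + a` (critical zeros of `ζ` shifted; Hardy's theorem through
`RamanujanAxiom.shiftedZeta_zeros_infinite`). [folklore] -/
theorem not_band_shiftedZeta {a : ℝ} (ha0 : 0 < a) (ha : a < 1 / 2) :
    ¬ ∀ ε : ℝ, 0 < ε → (bandSet (shiftedZeta a) ε).Finite := by
  intro h
  have hfin := h a ha0
  have hinf := (shiftedZeta_zeros_infinite a).1
  have hinj : Set.InjOn (fun t : ℝ => (1 / 2 + a + t * I : ℂ))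
      {t : ℝ | shiftedZeta a (1 / 2 + a + t * I) = 0} := by
    intro t _ t' _ h
    have := congrArg Complex.im h
    simpa using this
  have hsub : (fun t : ℝ => (1 / 2 + a + t * I : ℂ)) '' {t : ℝ | shiftedZeta a (1 / 2 + a + t * I) = 0}
      ⊆ bandSet (shiftedZeta a) a := by
    rintro _ ⟨t, ht, rfl⟩
    refine ⟨ht, ?_, ?_, ?_⟩ <;> simp <;> [linarith; linarith; rw [abs_of_pos ha0]]
  exact ((hinf.image hinj).mono hsub) hfin

/-- A zero `ρ` of `ζ` with `−2 < Re ρ` is a non-trivial zero: `0 < Re ρ < 1` (trivial zeros via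
the tree's `riemannZeta_eq_zero_iff_of_re_nonpos`, and Mathlib's `riemannZeta_ne_zero_of_one_le_re`).
[folklore] -/
theorem strip_of_zero_of_neg_two_lt {ρ : ℂ} (hz : riemannZeta ρ = 0) (h : -2 < ρ.re) :
    0 < ρ.re ∧ ρ.re < 1 := by
  constructor
  · by_contra h0
    obtain ⟨n, rfl⟩ :=
      (Literature.NumberTheory.LFunctions.riemannZeta_eq_zero_iff_of_re_nonpos (not_lt.1 h0)).1 hz
    rw [trivialZero_re] at h
    have : (0 : ℝ) ≤ n := n.cast_nonneg
    linarith
  · by_contra h1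
    exact riemannZeta_ne_zero_of_one_le_re (not_lt.1 h1) hz

/-- ABOVE ITS FIRST BAND `G_a` HAS EXACTLY THE BANDS OF `ζ`: the level-`ε` band of `G_a` consists
of `±a`-shifts of level-`(ε − a)` band zeros of `ζ` (content for `ε > a`). [folklore] -/
theorem bandSet_shiftedZeta_subset {a : ℝ} (ε : ℝ) (ha0 : 0 < a) (ha : a < 1 / 2) :
    bandSet (shiftedZeta a) ε ⊆
      (fun s => s + a) '' bandSet riemannZeta (ε - a) ∪
        (fun s => s - a) '' bandSet riemannZeta (ε - a) := by
  rintro s ⟨hz, h0, h1, hε'⟩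
  have hz' : riemannZeta (s - a) = 0 ∨ riemannZeta (s + a) = 0 := by
    rw [← mul_eq_zero]; exact hz
  rcases hz' with hz | hz
  · left
    have hre : (s - a).re = s.re - a := by simp
    obtain ⟨h0', h1'⟩ := strip_of_zero_of_neg_two_lt hz (by rw [hre]; linarith)
    refine ⟨s - a, ⟨hz, h0', h1', ?_⟩, by ring⟩
    rw [hre]
    have := abs_sub_abs_le_abs_sub (s.re - 1 / 2) a
    rw [abs_of_pos ha0] at this
    have e : s.re - 1 / 2 - a = s.re - a - 1 / 2 := by ring
    rw [e] at this
    linarith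
  · right
    have hre : (s + a).re = s.re + a := by simp
    obtain ⟨h0', h1'⟩ := strip_of_zero_of_neg_two_lt hz (by rw [hre]; linarith)
    refine ⟨s + a, ⟨hz, h0', h1', ?_⟩, by ring⟩
    rw [hre]
    have := abs_sub_abs_le_abs_sub (s.re - 1 / 2) (-a)
    rw [abs_neg, abs_of_pos ha0] at this
    have e : s.re - 1 / 2 - -a = s.re + a - 1 / 2 := by ring
    rw [e] at this
    linarith

/-- Hence under the crux every band of `G_a` of level `> a` is finite: the "Faure–Tsujii
statement with width `a`" for `G_a`. [folklore] -/
theorem bandSet_shiftedZeta_finite_of_acl (hacl : AsymptoticCriticalLine) {a ε : ℝ} (ha0 : 0 < a)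
    (ha : a < 1 / 2) (hε : a < ε) : (bandSet (shiftedZeta a) ε).Finite :=
  (((hacl _ (by linarith)).image _).union ((hacl _ (by linarith)).image _)).subset
    (bandSet_shiftedZeta_subset ε ha0 ha)

/-- Conversely the right half-band of `ζ` of level `ε > 2a` shifts by `−a` into the
level-`(ε − a)` band of `G_a`. [folklore] -/
theorem rightBandSet_subset_shiftedZeta {a ε : ℝ} (ha0 : 0 < a) (hε : 2 * a < ε) :
    rightBandSet ε ⊆ (fun s => s + a) '' bandSet (shiftedZeta a) (ε - a) := by
  rintro ρ ⟨hz, hre, h1⟩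
  refine ⟨ρ - a, ⟨?_, ?_, ?_, ?_⟩, by ring⟩
  · show riemannZeta (ρ - a - a) * riemannZeta (ρ - a + a) = 0
    rw [sub_add_cancel, hz, mul_zero]
  · simp; linarith
  · simp; linarith
  · simp only [sub_re, ofReal_re]
    rw [abs_of_pos (by linarith)]
    linarith

/-- THE CRUX ⟺ THE WIDTH-`a` BAND STATEMENTS FOR THE WHOLE NON-TEMPERED FAMILY: `ζ` satisfies
the crux iff for every `0 < a < 1/2` all bands of `G_a = ζ(s−a)ζ(s+a)` of level `> a` are finite
(`⇐`: the one-sided form `acl_iff_rightBand` of `BandForms.lean` with `a = ε/4`). So the natural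
output of band theory for a flow with unequal minimal/maximal expansion rates — a band of positive
width with all but finitely many resonances inside — is, on this family, exactly as strong as the
crux and no stronger; only width `0` is the crux itself. [folklore] -/
theorem acl_iff_forall_shiftedZeta :
    AsymptoticCriticalLine ↔
      ∀ a : ℝ, 0 < a → a < 1 / 2 → ∀ ε : ℝ, a < ε → (bandSet (shiftedZeta a) ε).Finite := by
  refine ⟨fun h a ha0 ha ε hε => bandSet_shiftedZeta_finite_of_acl h ha0 ha hε, fun h => ?_⟩
  rw [acl_iff_rightBand]
  intro ε hε
  by_cases hlt : ε < 1 / 2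
  · have ha0 : 0 < ε / 4 := by linarith
    have := (h (ε / 4) ha0 (by linarith) (ε - ε / 4) (by linarith)).image
      (fun s => s + ((ε / 4 : ℝ) : ℂ))
    exact this.subset (rightBandSet_subset_shiftedZeta ha0 (by linarith))
  · refine Set.finite_empty.subset ?_
    rintro s ⟨_, hre, h1⟩
    linarith

end shifted

/-! ## 2. Every OTHER level set of `ζ` fills every band (Titchmarsh §11.10) -/

/-- REFUTED STRENGTHENING (unconditional; Titchmarsh §11.10 `a`-points theorem, PROVED in tree as
`Literature.Barriers.RiemannHypothesis.Titchmarsh1986_aPoints_holds`): for every `a ≠ 0` and EVERY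
level `0 < ε < 1/2`, the level-`ε` band of `ζ − a` is infinite (`> K T` points `ζ = a` with
`1/2 + ε < Re s < 3/4 + ε/2`, `0 < Im s < T`). The crux asserts for the value `0` what fails
maximally for every other value (barrier `BohrDenseValues` bites on every `a ≠ 0`). [folklore] -/
theorem bandSet_zeta_sub_const_infinite {a : ℂ} (ha : a ≠ 0) {ε : ℝ} (hε0 : 0 < ε) (hε : ε < 1 / 2) :
    (bandSet (fun s => riemannZeta s - a) ε).Infinite := by
  intro hfin
  obtain ⟨K, hK, T₀, hT⟩ :=
    Literature.Barriers.RiemannHypothesis.Titchmarsh1986_aPoints_holds a ha (1 / 2 + ε)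
      (3 / 4 + ε / 2) (by linarith) (by linarith) (by linarith)
  set N : ℕ := hfin.toFinset.card with hN
  obtain ⟨F, hF, hcard⟩ := hT (max (T₀ + 1) (((N : ℝ) + 1) / K))
    (lt_of_lt_of_le (by linarith) (le_max_left _ _))
  have hsub : ∀ ρ ∈ F, ρ ∈ bandSet (fun s => riemannZeta s - a) ε := by
    intro ρ hρ
    obtain ⟨h1, h2, -, -, h5⟩ := hF ρ hρ
    refine ⟨?_, by linarith, by linarith, ?_⟩
    · show riemannZeta ρ - a = 0
      rw [h5, sub_self]
    · rw [abs_of_pos (by linarith)]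
      linarith
  have hcardle : F.card ≤ N := Finset.card_le_card fun ρ hρ => hfin.mem_toFinset.2 (hsub ρ hρ)
  have hge : (N : ℝ) + 1 ≤ K * max (T₀ + 1) (((N : ℝ) + 1) / K) :=
    calc (N : ℝ) + 1 = K * (((N : ℝ) + 1) / K) := by field_simp
      _ ≤ K * max (T₀ + 1) (((N : ℝ) + 1) / K) := by gcongr; exact le_max_right _ _
  have h2 : (F.card : ℝ) ≤ N := by exact_mod_cast hcardle
  linarith

/-- Hence the band shape fails for `ζ − a`, `a ≠ 0`. [folklore] -/
theorem not_band_zeta_sub_const {a : ℂ} (ha : a ≠ 0) :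
    ¬ ∀ ε : ℝ, 0 < ε → (bandSet (fun s => riemannZeta s - a) ε).Finite := fun h =>
  bandSet_zeta_sub_const_infinite ha (by norm_num : (0 : ℝ) < 1 / 4) (by norm_num) (h _ (by norm_num))


/-! ## 3. Differentiation destroys the band: `ζ'` (Voronin universality + Cauchy + Rouché, all in tree) -/

section deriv_zeta

open Metric MeasureTheory
open Literature.Barriers.RiemannHypothesis (HasPosLowerDensity exists_zero_of_norm_sub_lt_norm)

/-- `ζ'` is analytic away from `s = 1`. [folklore] -/
theorem analyticOnNhd_deriv_riemannZeta : AnalyticOnNhd ℂ (deriv riemannZeta) {s : ℂ | s ≠ 1} := by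
  have hopen : IsOpen {s : ℂ | s ≠ 1} := isOpen_ne
  have hd : DifferentiableOn ℂ riemannZeta {s : ℂ | s ≠ 1} :=
    fun s hs => (differentiableAt_riemannZeta hs).differentiableWithinAt
  exact (hd.analyticOnNhd hopen).deriv

/-- ZEROS OF `ζ'` ABOVE EVERY HEIGHT IN EVERY STRIP `1/2 < α < Re s < β < 1` (Voronin's universality
theorem on discs, PROVED in tree as
`Literature.NumberTheory.LFunctions.Steuding2007_thm1_9_discAnalytic_holds`, then Cauchy's estimate
and Rouché): with `σ₀ = (α+β)/2`, `ρ = (β−α)/4`, approximate `g(s) = 1 + (s − σ₀)²/(8ρ²)` within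
`1/8` on `|s − σ₀| ≤ 2ρ` by `ζ(s + iτ)`, `τ` large; then `ζ'(· + iτ)` is within `1/(8ρ)` of
`g' = (s − σ₀)/(4ρ²)` on `|s − σ₀| = ρ`, where `|g'| = 1/(4ρ)`, so `ζ'(· + iτ)` vanishes in
`|s − σ₀| < ρ`. [folklore] -/
theorem exists_deriv_zeta_zero_gt {α β : ℝ} (hα : 1 / 2 < α) (hαβ : α < β) (hβ : β < 1) (T₁ : ℝ) :
    ∃ s : ℂ, deriv riemannZeta s = 0 ∧ α < s.re ∧ s.re < β ∧ T₁ < s.im := by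
  -- geometry of the discs
  obtain ⟨σ₀, hσ₀⟩ : ∃ σ₀ : ℝ, σ₀ = (α + β) / 2 := ⟨_, rfl⟩
  obtain ⟨ρ, hρ⟩ : ∃ ρ : ℝ, ρ = (β - α) / 4 := ⟨_, rfl⟩
  have hρ0 : 0 < ρ := by rw [hρ]; linarith
  -- the quadratic target `g = 1 + lam (s - σ₀)²`, `lam = 1/(8ρ²)`
  obtain ⟨lam, hlam⟩ : ∃ lam : ℂ, lam = ((1 / (8 * ρ ^ 2) : ℝ) : ℂ) := ⟨_, rfl⟩
  obtain ⟨g, hg⟩ : ∃ g : ℂ → ℂ, g = fun s => 1 + lam * ((s - σ₀) * (s - σ₀)) := ⟨_, rfl⟩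
  have hgD : Differentiable ℂ g := by
    rw [hg]; fun_prop
  have hg' : ∀ w : ℂ, HasDerivAt g (2 * lam * (w - σ₀)) w := by
    intro w
    rw [hg]
    have h1 : HasDerivAt (fun s : ℂ => s - σ₀) 1 w := (hasDerivAt_id w).sub_const _
    have h2 : HasDerivAt (fun s : ℂ => (s - σ₀) * (s - σ₀)) (1 * (w - σ₀) + (w - σ₀) * 1) w :=
      h1.mul h1
    have h3 : HasDerivAt (fun s : ℂ => lam * ((s - σ₀) * (s - σ₀)))
        (lam * (1 * (w - σ₀) + (w - σ₀) * 1)) w := h2.const_mul lam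
    have h4 : HasDerivAt (fun s : ℂ => 1 + lam * ((s - σ₀) * (s - σ₀)))
        (lam * (1 * (w - σ₀) + (w - σ₀) * 1)) w := h3.const_add 1
    have e : lam * (1 * (w - σ₀) + (w - σ₀) * 1) = 2 * lam * (w - σ₀) := by ring
    rw [e] at h4
    exact h4
  have hlamnorm : ‖lam‖ = 1 / (8 * ρ ^ 2) := by
    rw [hlam, Complex.norm_real, Real.norm_of_nonneg (by positivity)]
  have hg0 : ∀ s ∈ closedBall (σ₀ : ℂ) (2 * ρ), g s ≠ 0 := by
    intro s hs
    rw [mem_closedBall, dist_eq_norm] at hs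
    have hbound : ‖lam * ((s - σ₀) * (s - σ₀))‖ ≤ 1 / 2 := by
      rw [norm_mul, norm_mul, hlamnorm]
      have hs2 : ‖s - (σ₀ : ℂ)‖ * ‖s - (σ₀ : ℂ)‖ ≤ (2 * ρ) * (2 * ρ) :=
        mul_le_mul hs hs (norm_nonneg _) (by positivity)
      calc 1 / (8 * ρ ^ 2) * (‖s - ↑σ₀‖ * ‖s - ↑σ₀‖)
          ≤ 1 / (8 * ρ ^ 2) * ((2 * ρ) * (2 * ρ)) := by gcongr
        _ = 1 / 2 := by field_simp; ring
    intro h0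
    have h0' : 1 + lam * ((s - σ₀) * (s - σ₀)) = 0 := by rw [hg] at h0; exact h0
    have e : (1 : ℂ) = -(lam * ((s - σ₀) * (s - σ₀))) := by linear_combination h0'
    have h1 : ‖(1 : ℂ)‖ ≤ 1 / 2 := by rw [e, norm_neg]; exact hbound
    norm_num at h1
  have hlo : 1 / 2 < (σ₀ : ℂ).re - 2 * ρ := by rw [ofReal_re, hσ₀, hρ]; linarith
  have hhi : (σ₀ : ℂ).re + 2 * ρ < 1 := by rw [ofReal_re, hσ₀, hρ]; linarith
  -- universality: good shifts have positive lower density, hence occur above every height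
  obtain ⟨δ, hδ, T₀, hT₀⟩ :=
    Literature.NumberTheory.LFunctions.Steuding2007_thm1_9_discAnalytic_holds (σ₀ : ℂ) (2 * ρ)
      (3 * ρ) (by positivity) (by linarith) hlo hhi g hgD.differentiableOn hg0 (1 / 8) (by norm_num)
  have hA : HasPosLowerDensity
      {τ : ℝ | ∀ s ∈ closedBall (σ₀ : ℂ) (2 * ρ), ‖riemannZeta (s + τ * I) - g s‖ < 1 / 8} :=
    ⟨δ, hδ, T₀, hT₀⟩
  obtain ⟨τ, hτ, hτT⟩ := hA.exists_gt (T₁ + ρ)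
  -- differentiability of the shifted functions on `Re s < 1`
  have hsub1 : closedBall (σ₀ : ℂ) (2 * ρ) ⊆ {s : ℂ | s.re < 1} := by
    intro s hs
    rw [mem_closedBall, dist_eq_norm] at hs
    have h := (abs_re_le_norm (s - σ₀)).trans hs
    rw [sub_re, ofReal_re, abs_le] at h
    show s.re < 1
    linarith [h.2]
  have hne1 : ∀ s : ℂ, s.re < 1 → s + τ * I ≠ 1 := fun s hs h => by
    have := congrArg Complex.re h
    simp at this
    linarith
  have hFdiff : DifferentiableOn ℂ (fun s => riemannZeta (s + τ * I) - g s) {s : ℂ | s.re < 1} := by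
    intro s hs
    exact (((differentiableAt_riemannZeta (hne1 s hs)).comp s
      (differentiableAt_id.add_const _)).sub (hgD s)).differentiableWithinAt
  have hGdiff : DifferentiableOn ℂ (fun s => deriv riemannZeta (s + τ * I)) {s : ℂ | s.re < 1} := by
    intro s hs
    exact ((analyticOnNhd_deriv_riemannZeta _ (hne1 s hs)).differentiableAt.comp s
      (differentiableAt_id.add_const _)).differentiableWithinAt
  -- Cauchy's estimate on the circle `|w - σ₀| = ρ`
  have hderiv_close : ∀ w ∈ sphere (σ₀ : ℂ) ρ,
      ‖deriv riemannZeta (w + τ * I) - 2 * lam * (w - σ₀)‖ ≤ (1 / 8) / ρ := by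
    intro w hw
    have hwball : closedBall w ρ ⊆ closedBall (σ₀ : ℂ) (2 * ρ) := by
      intro z hz
      rw [mem_closedBall] at hz ⊢
      have hw' := mem_sphere.1 hw
      calc dist z σ₀ ≤ dist z w + dist w σ₀ := dist_triangle _ _ _
        _ ≤ ρ + ρ := add_le_add hz hw'.le
        _ = 2 * ρ := by ring
    have hF : DiffContOnCl ℂ (fun s => riemannZeta (s + τ * I) - g s) (ball w ρ) :=
      hFdiff.diffContOnCl_ball (hwball.trans hsub1)
    have hC : ∀ z ∈ sphere w ρ, ‖riemannZeta (z + τ * I) - g z‖ ≤ 1 / 8 :=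
      fun z hz => (hτ z (hwball (sphere_subset_closedBall hz))).le
    have hest := Complex.norm_deriv_le_of_forall_mem_sphere_norm_le hρ0 hF hC
    have hw1 : w.re < 1 := hsub1 (hwball (mem_closedBall_self hρ0.le))
    have hHas : HasDerivAt (fun s => riemannZeta (s + τ * I) - g s)
        (deriv riemannZeta (w + τ * I) * 1 - 2 * lam * (w - σ₀)) w := by
      have hζ := (differentiableAt_riemannZeta (hne1 w hw1)).hasDerivAt
      have hadd : HasDerivAt (fun s : ℂ => s + τ * I) 1 w := (hasDerivAt_id w).add_const _
      exact (hζ.comp w hadd).sub (hg' w)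
    rw [hHas.deriv, mul_one] at hest
    exact hest
  -- Rouché in `|w - σ₀| < ρ` against `g' = 2 lam (s - σ₀)`, `|g'| = 1/(4ρ)` on the circle
  have hf : DiffContOnCl ℂ (fun s : ℂ => 2 * lam * (s - σ₀)) (ball (σ₀ : ℂ) ρ) :=
    Differentiable.diffContOnCl (by fun_prop)
  have hGd : DiffContOnCl ℂ (fun s => deriv riemannZeta (s + τ * I)) (ball (σ₀ : ℂ) ρ) :=
    hGdiff.diffContOnCl_ball ((closedBall_subset_closedBall (by linarith)).trans hsub1)
  have h2 : ‖(2 : ℂ)‖ = 2 := by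
    rw [show (2 : ℂ) = ((2 : ℝ) : ℂ) by norm_num, Complex.norm_real]
    norm_num
  have hsphere : ∀ w ∈ sphere (σ₀ : ℂ) ρ,
      ‖deriv riemannZeta (w + τ * I) - 2 * lam * (w - σ₀)‖ < ‖2 * lam * (w - σ₀)‖ := by
    intro w hw
    have hw' : ‖w - σ₀‖ = ρ := by rw [← dist_eq_norm]; exact mem_sphere.1 hw
    have e : ‖2 * lam * (w - σ₀)‖ = 1 / (4 * ρ) := by
      rw [norm_mul, norm_mul, hlamnorm, hw', h2]
      field_simp
      ring
    rw [e]
    refine (hderiv_close w hw).trans_lt ?_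
    rw [div_div]
    exact one_div_lt_one_div_of_lt (by positivity) (by linarith)
  obtain ⟨z, hz, hz0⟩ := exists_zero_of_norm_sub_lt_norm hρ0 hf hGd (mem_ball_self hρ0)
    (by simp) hsphere
  rw [mem_ball, dist_eq_norm] at hz
  have hre : |z.re - σ₀| < ρ := by
    have := (abs_re_le_norm (z - σ₀)).trans_lt hz
    simpa using this
  have him : |z.im| < ρ := by
    have := (abs_im_le_norm (z - σ₀)).trans_lt hz
    simpa using this
  rw [abs_lt] at hre him
  refine ⟨z + τ * I, hz0, ?_, ?_, ?_⟩
  · simp only [add_re, mul_re, ofReal_re, I_re, mul_zero, ofReal_im, I_im, mul_one, sub_self,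
      add_zero]
    rw [hσ₀, hρ] at hre
    linarith [hre.1]
  · simp only [add_re, mul_re, ofReal_re, I_re, mul_zero, ofReal_im, I_im, mul_one, sub_self,
      add_zero]
    rw [hσ₀, hρ] at hre
    linarith [hre.2]
  · simp only [add_im, mul_im, ofReal_re, I_im, mul_one, ofReal_im, I_re, mul_zero, add_zero]
    linarith [him.1]

/-- Hence `ζ'` has infinitely many zeros in every strip `1/2 < α < Re s < β < 1`
(Titchmarsh Thm. 11.5 (C) gives this only for `1 < σ < E`; in `1/2 < σ < 1` it is Voronin).
[folklore] -/
theorem deriv_zeta_zeros_infinite {α β : ℝ} (hα : 1 / 2 < α) (hαβ : α < β) (hβ : β < 1) :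
    {s : ℂ | deriv riemannZeta s = 0 ∧ α < s.re ∧ s.re < β}.Infinite := by
  intro hfin
  obtain ⟨T, hT⟩ := (hfin.image fun s : ℂ => s.im).bddAbove
  obtain ⟨s, hs0, h1, h2, h3⟩ := exists_deriv_zeta_zero_gt hα hαβ hβ T
  have hle : s.im ≤ T := hT (Set.mem_image_of_mem (fun s : ℂ => s.im) ⟨hs0, h1, h2⟩)
  exact (lt_irrefl T) (h3.trans_le hle)

/-- REFUTED STRENGTHENING (unconditional): every band of `ζ'` of level `0 < ε < 1/2` is
INFINITE — the band shape fails for the derivative, through its RIGHT half. Its LEFT half is of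
RH strength: `RH ⟺ ζ'` has no zeros in `0 < σ < 1/2` (Speiser 1934), and unconditionally the
zeros of `ζ'` in `σ < 1/2` are as many as the off-line zeros of `ζ` there up to `O(log T)`
(Levinson–Montgomery 1974). So: (i) the band property is not inherited under differentiation /
is not a property of the linear-differential structure of `ζ`; (ii) the symmetry `ρ ↦ 1 − ρ̄`,
which makes the one-sided and two-sided forms of the crux equivalent (`acl_iff_rightBand`), is
exactly what `ζ'` lacks — for `ζ'` "one-sided" (left) is plausible and "two-sided" is false.
[folklore] -/
theorem bandSet_deriv_zeta_infinite {ε : ℝ} (hε0 : 0 < ε) (hε : ε < 1 / 2) :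
    (bandSet (deriv riemannZeta) ε).Infinite := by
  refine (deriv_zeta_zeros_infinite (α := 1 / 2 + ε) (β := 3 / 4 + ε / 2) (by linarith)
    (by linarith) (by linarith)).mono ?_
  rintro s ⟨hz, h1, h2⟩
  exact ⟨hz, by linarith, by linarith, by rw [abs_of_pos (by linarith)]; linarith⟩

/-- The band shape fails for `ζ'`. [folklore] -/
theorem not_band_deriv_zeta : ¬ ∀ ε : ℝ, 0 < ε → (bandSet (deriv riemannZeta) ε).Finite := fun h =>
  bandSet_deriv_zeta_infinite (by norm_num : (0 : ℝ) < 1 / 4) (by norm_num) (h _ (by norm_num))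

end deriv_zeta

end Summit.RiemannHypothesis.RiemannHypothesis.Theorems.AsymptoticCriticalLine.Negative

end
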